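import Mathlib.Logic.Equiv.Fintype
import Mathlib.Data.Finset.Sum
import Literature.Computability.AlgebraicComplexity.LR21CanonicalWeights
import Literature.Computability.AlgebraicComplexity.LR21Count
import Literature.Computability.AlgebraicComplexity.LR21Datum
import HarnessLib

/-!
# Landsberg–Ressayre, Thm. 2.1 (lower bound) — the two-sided chain with profiles, the count
  `C(2m,m) - 1`, and the assembly: `lr_full_equivariant_lower` holds

Topic `Literature/Computability/AlgebraicComplexity`.  Final file of the bottom-up proof of the
named fact `lr_full_equivariant_lower` (`LandsbergRessayre.lean`; LR17 Thm. 2.1, `≥` half: an affine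
determinantal representation of `perm_m`, `m ≥ 3`, over `ℂ`, equivariant — exact lifts — for the full
realised symmetry group `permSymmetrySubst` has size `n ≥ C(2m, m) - 1`).  The chain of files is

`LandsbergRessayreNormalForm` (regularity, normal form `Λ_{n-1}`; von zur Gathen's theorem, PROVED in
`VonZurGathenRegularityProofs` / `VonZurGathenSingPermHeight`) → `LRCanonicalSubspaces`,
`LR21CanonicalSubspaces` (canonical subspaces `𝒫_S`, `S ⊆ [m] ⊔ [m]`, two-sided lifts `Lift₂`,
covariance, escape) → `LRTorusWeights`, `LR21TorusWeights`, `LR21CanonicalWeights` (weights of ONE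
generic two-sided torus element on the `𝒫_S`, grid, descent) → `LRLiftCharacter` (the character of
a lift: the top weight is `(∏ p ∏ q) γ₀`, LR17 Lemma 3.1/3.3) → `LRFullLifts`, `LR21Datum` (from
the tree's `IsEquivariantDetRepr (permSymmetrySubst ℂ m)` to the datum with all hypotheses),
`LR21Count` (`Σ_{s=1}^{m-1} C(m,s)² = C(2m,m) - 2`) → here.

**Part 1 (abstract, for a two-sided torus datum `D`; LR17 §6, last page, two-sidedly):**
* escape and the TOP WEIGHT: granted "every weight `β ≠ wt 1` lies in `range Λ`" (property (iv) of
  `LR21Datum.exists_torusData₂`), the weight of `𝒫_{[m]⊔[m]}` outside `range Λ` is `wt 1`, of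
  exponent `(1,…,1;1,…,1)` (`good_one`);
* the chain WITH PROFILES (`exists_good_profile`): descending from `1` by steps
  `st k j = e_{inl k} + e_{inr j}` keeps the exponent `0/1`-valued with EQUAL row- and column-degree,
  so for every `1 ≤ s ≤ m` there is a good exponent whose support has `s` rows and `s` columns
  (this is where LR's "very similar" proof of Thm. 2.1 needs the pinned top character: with an
  unpinned top the descent could leave the diagonal of profiles);
* newness and its transport by the lifts of permutation PAIRS (`new_map`), transitivity of
  `𝔖_m × 𝔖_m` on supports with profile `(s, s)` (`exists_perm_pair_map_eq`): every `R ⊔ T` with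
  `|R| = |T| = s` is full (`full_disjSum`);
* the count (`choose_sub_one_le_finrank`): the `C(2m,m) - 2` weights of support `R ⊔ T`
  (`|R| = |T| = s`, `1 ≤ s ≤ m-1`) plus the top weight are pairwise distinct and all occur, so
  `dim V ≥ C(2m, m) - 1`.

**Part 2 (assembly):**
* `choose_sub_one_le_of_isEquivariantDetRepr`: the bound for one representation;
* `lr_full_equivariant_lower_holds`: the DISCHARGE of the named fact;
* `le_equivariantDetComplexity_full`: `edc(perm_m) ≥ C(2m,m) - 1` for the full symmetry group
  whenever some fully equivariant representation exists (LR17 Prop. 2.10 gives one of exactly this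
  size; the matching upper bound is not vendored).

The proof replaces LR's Levi–Malcev decompositions, central tori and finite covers (LR17 §3.5–§6) by
the canonical subspaces of the pencil and one generic torus element; the only inputs beyond linear
algebra are von zur Gathen's regularity theorem (proved in the tree) and unique factorisation.  Only
the torus pairs and the permutation pairs of `𝔾_{perm_m}` are used (the transposition is not needed
for the lower bound).  Everything is proved; no named facts.

## References

* J. M. Landsberg, N. Ressayre, *Permanent v. determinant: an exponential lower bound assuming
  symmetry and a potential path towards Valiant's conjecture*, Differential Geom. Appl. 55 (2017)
  146–166, arXiv:1508.05788: Thm. 2.1, Prop. 2.10, Lemmas 3.1–3.3, §6 (pp. 14–16).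
* J. von zur Gathen, *Permanent and determinant*, Linear Algebra Appl. 96 (1987) 87–100, Thm. 3.1.
-/

noncomputable section

namespace Literature.Computability.AlgebraicComplexity

namespace LRPencil

namespace TorusData₂

open Submodule Module.End Finset

variable {V : Type*} [AddCommGroup V] [Module ℂ V] {m : ℕ} (D : TorusData₂ m V)

/-! ### Degrees and the row/column parts of a support -/

section Profile

/-- The row degree `Σ_k w (inl k)` of an exponent. [cite: LandsbergRessayre2017, §6] -/
def rowDeg (w : Fin m ⊕ Fin m → ℕ) : ℕ := ∑ k, w (Sum.inl k)

/-- The column degree `Σ_j w (inr j)` of an exponent. [cite: LandsbergRessayre2017, §6] -/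
def colDeg (w : Fin m ⊕ Fin m → ℕ) : ℕ := ∑ j, w (Sum.inr j)

/-- The rows in the support. [cite: LandsbergRessayre2017, §6] -/
def rows (w : Fin m ⊕ Fin m → ℕ) : Finset (Fin m) := univ.filter fun k => w (Sum.inl k) ≠ 0

/-- The columns in the support. [cite: LandsbergRessayre2017, §6] -/
def cols (w : Fin m ⊕ Fin m → ℕ) : Finset (Fin m) := univ.filter fun j => w (Sum.inr j) ≠ 0

/-- `rowDeg (w' + st k j) = rowDeg w' + 1`. [folklore] -/
theorem rowDeg_add_st (w : Fin m ⊕ Fin m → ℕ) (k j : Fin m) : rowDeg (w + st k j) = rowDeg w + 1 := by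
  simp only [rowDeg, Pi.add_apply, sum_add_distrib]
  congr 1
  rw [sum_eq_single k]
  · exact st_apply_inl k j
  · intro k' _ hk'
    exact st_apply_of_ne (by simpa using hk') (by simp)
  · simp

/-- `colDeg (w' + st k j) = colDeg w' + 1`. [folklore] -/
theorem colDeg_add_st (w : Fin m ⊕ Fin m → ℕ) (k j : Fin m) : colDeg (w + st k j) = colDeg w + 1 := by
  simp only [colDeg, Pi.add_apply, sum_add_distrib]
  congr 1
  rw [sum_eq_single j]
  · exact st_apply_inr k j
  · intro j' _ hj'
    exact st_apply_of_ne (by simp) (by simpa using hj')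
  · simp

/-- `rowDeg 1 = m`. [folklore] -/
theorem rowDeg_one : rowDeg (fun _ : Fin m ⊕ Fin m => 1) = m := by simp [rowDeg]

/-- `colDeg 1 = m`. [folklore] -/
theorem colDeg_one : colDeg (fun _ : Fin m ⊕ Fin m => 1) = m := by simp [colDeg]

/-- For a `0/1`-valued exponent the number of rows in the support is the row degree. [folklore] -/
theorem card_rows_eq {w : Fin m ⊕ Fin m → ℕ} (hw : ∀ x, w x ≤ 1) : (rows w).card = rowDeg w := by
  rw [rowDeg, rows, card_eq_sum_ones, sum_filter]
  refine sum_congr rfl fun k _ => ?_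
  have := hw (Sum.inl k)
  by_cases h : w (Sum.inl k) = 0
  · simp [h]
  · rw [if_pos h]; omega

/-- The same for columns. [folklore] -/
theorem card_cols_eq {w : Fin m ⊕ Fin m → ℕ} (hw : ∀ x, w x ≤ 1) : (cols w).card = colDeg w := by
  rw [colDeg, cols, card_eq_sum_ones, sum_filter]
  refine sum_congr rfl fun j _ => ?_
  have := hw (Sum.inr j)
  by_cases h : w (Sum.inr j) = 0
  · simp [h]
  · rw [if_pos h]; omega

/-- The support is the disjoint sum of its rows and its columns. [folklore] -/
theorem supp₂_eq_disjSum (w : Fin m ⊕ Fin m → ℕ) : supp₂ w = (rows w).disjSum (cols w) := by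
  ext x
  rcases x with k | j
  · simp [rows, Finset.mem_disjSum]
  · simp [cols, Finset.mem_disjSum]

/-- A step vector has row degree `1`. [folklore] -/
theorem rowDeg_st (k j : Fin m) : rowDeg ((0 : Fin m ⊕ Fin m → ℕ) + st k j) = 1 := by
  rw [rowDeg_add_st]; simp [rowDeg]

end Profile

/-! ### Escape and the top weight -/

section Top

variable [FiniteDimensional ℂ V]

/-- `w` is GOOD if `0 ≠ w` and `wt w` is a weight of `𝒫_{[m] ⊔ [m]}`. [cite: LandsbergRessayre2017, §6] -/
def Good (w : Fin m ⊕ Fin m → ℕ) : Prop := w ∈ U₂ univ ∧ canon₂ D.Λ D.A univ ⊓ D.E (D.wt w) ≠ ⊥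

/-- `S` is FULL if `𝒫_S` has a weight of support exactly `S`. [cite: LandsbergRessayre2017, §6] -/
def Full (S : Finset (Fin m ⊕ Fin m)) : Prop :=
  ∃ w ∈ U₂ S, supp₂ w = S ∧ canon₂ D.Λ D.A S ⊓ D.E (D.wt w) ≠ ⊥

/-- `S` is NEW if `𝒫_S ⊄ Σ_{S' ⊊ S} 𝒫_{S'}` (covariant under the lifts). [cite: LandsbergRessayre2017, §6] -/
def New (S : Finset (Fin m ⊕ Fin m)) : Prop :=
  ¬ canon₂ D.Λ D.A S ≤ ⨆ (S' : Finset (Fin m ⊕ Fin m)) (_ : S' ⊂ S), canon₂ D.Λ D.A S'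

/-- If `𝒫_S ⊄ range Λ` then some weight piece of `𝒫_S` is `⊄ range Λ`. [cite: LandsbergRessayre2017, §6] -/
theorem exists_wt_of_not_le_range {S : Finset (Fin m ⊕ Fin m)}
    (h : ¬ canon₂ D.Λ D.A S ≤ LinearMap.range D.Λ) :
    ∃ w ∈ U₂ S, ¬ canon₂ D.Λ D.A S ⊓ D.E (D.wt w) ≤ LinearMap.range D.Λ := by
  by_contra hall
  push Not at hall
  exact h ((D.canon₂_le_iSup_inf S).trans (iSup_le fun w => hall w w.2))

/-- **The top exponent is `(1, …, 1; 1, …, 1)`** (LR17 §6, the character of `ℓ_2`, two-sidedly):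
if `dim ker Λ = 1`, some member of the pencil is injective, and every weight `β ≠ wt 1` lies in
`range Λ`, then `1` is good. [cite: LandsbergRessayre2017, §6] -/
theorem good_one (hK : Module.finrank ℂ (LinearMap.ker D.Λ) = 1)
    (hgen : ∃ x : Fin m → Fin m → ℂ, Function.Injective (D.Λ + ∑ k, ∑ j, x k j • D.A k j))
    (htop : ∀ β, β ≠ D.wt (fun _ => 1) → D.E β ≤ LinearMap.range D.Λ) :
    D.Good (fun _ => 1) := by
  have hK0 : LinearMap.ker D.Λ ≠ ⊥ := by
    intro h; rw [h, finrank_bot] at hK; exact zero_ne_one hK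
  have hesc : ¬ canon₂ D.Λ D.A univ ≤ LinearMap.range D.Λ := by
    rw [canon₂_univ]; exact not_canon_univ_le_range (A := D.A) hK0 hgen
  obtain ⟨w₀, hw₀, hne⟩ := D.exists_wt_of_not_le_range hesc
  have hw : D.wt w₀ = D.wt (fun _ => 1) := by
    by_contra hne'
    exact hne (inf_le_right.trans (htop _ hne'))
  have heq : w₀ = fun _ => 1 := D.wt_injective hw
  subst heq
  exact ⟨hw₀, fun h => hne (by rw [h]; exact bot_le)⟩

end Top

/-! ### The chain with profiles -/

section Chain

variable [FiniteDimensional ℂ V]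

/-- One descent step preserves goodness: a good `w` of row degree `≥ 2` is `w' + st k j` with `w'`
good (LR17 §6). [cite: LandsbergRessayre2017, §6] -/
theorem exists_good_pred {w : Fin m ⊕ Fin m → ℕ} (hw : D.Good w) (h2 : 2 ≤ rowDeg w) :
    ∃ k j w', w = w' + st k j ∧ D.Good w' := by
  have hu1 : ∀ k j, w ≠ 0 + st k j := by
    intro k j hk; rw [hk, rowDeg_st] at h2; omega
  obtain ⟨k, j, -, -, w', hw', rfl, hne⟩ := D.exists_pred_of_canon₂_inf_wt_ne_bot hu1 hw.2
  exact ⟨k, j, w', rfl, hw', fun h => hne (by rw [h, bot_inf_eq])⟩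

/-- **The chain with profiles** (LR17 §6, two-sidedly, from the pinned top): if `1` is good then for
every `t ≤ m - 1` there is a good `0/1`-valued exponent of row degree AND column degree `m - t`.
[cite: LandsbergRessayre2017, §6] -/
theorem exists_good_profile (hgood : D.Good (fun _ => 1)) :
    ∀ t, t ≤ m - 1 → ∃ w, D.Good w ∧ (∀ x, w x ≤ 1) ∧ rowDeg w = m - t ∧ colDeg w = m - t := by
  intro t
  induction t with
  | zero =>
    intro _
    exact ⟨fun _ => 1, hgood, fun _ => le_rfl, by rw [rowDeg_one]; omega, by rw [colDeg_one]; omega⟩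
  | succ t ih =>
    intro ht
    obtain ⟨w, hw, hw1, hr, hc⟩ := ih (by omega)
    obtain ⟨k, j, w', rfl, hw'⟩ := D.exists_good_pred hw (by omega)
    refine ⟨w', hw', fun x => le_trans (Nat.le_add_right _ _) (hw1 x), ?_, ?_⟩
    · rw [rowDeg_add_st] at hr; omega
    · rw [colDeg_add_st] at hc; omega

end Chain

/-! ### Full and new; transport along permutation pairs -/

section FullNew

variable [FiniteDimensional ℂ V]

/-- A good exponent makes its support full. [cite: LandsbergRessayre2017, §6] -/
theorem full_supp_of_good {w : Fin m ⊕ Fin m → ℕ} (hw : D.Good w) : D.Full (supp₂ w) :=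
  ⟨w, ⟨hw.1.1, subset_rfl⟩, rfl, fun h => hw.2 (by
    rw [eq_bot_iff, ← h]; exact D.canon₂_inf_wt_le hw.1 subset_rfl)⟩

/-- FULL implies NEW. [cite: LandsbergRessayre2017, §6] -/
theorem new_of_full {S : Finset (Fin m ⊕ Fin m)} (hS : D.Full S) : D.New S := by
  obtain ⟨w, hw, hsupp, hne⟩ := hS
  intro hle
  apply hne
  let ι := {q : Finset (Fin m ⊕ Fin m) × (Fin m ⊕ Fin m → ℕ) // q.1 ⊂ S ∧ q.2 ∈ U₂ q.1}
  have hgrid : (⨆ (S' : Finset (Fin m ⊕ Fin m)) (_ : S' ⊂ S), canon₂ D.Λ D.A S') ≤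
      ⨆ q : ι, D.E (D.wt q.1.2) :=
    iSup₂_le fun S' hS' => (D.canon₂_le_grid S').trans
      (iSup_le fun w' => le_iSup (fun q : ι => D.E (D.wt q.1.2)) ⟨(S', w'.1), hS', w'.2⟩)
  have hwne : ∀ q : ι, D.wt q.1.2 ≠ D.wt w := fun q h => by
    have h' := D.wt_injective h
    have : supp₂ w ⊂ S := by
      rw [← h']; exact lt_of_le_of_lt (α := Finset (Fin m ⊕ Fin m)) q.2.2.2 q.2.1
    rw [hsupp] at this
    exact lt_irrefl _ this
  rw [eq_bot_iff]
  calc canon₂ D.Λ D.A S ⊓ D.E (D.wt w) ≤ (⨆ q : ι, D.E (D.wt q.1.2)) ⊓ D.E (D.wt w) :=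
        inf_le_inf_right _ (hle.trans hgrid)
    _ = ⊥ := iSup_maxGen_inf_eq_bot _ _ hwne

/-- NEW implies FULL. [cite: LandsbergRessayre2017, §6] -/
theorem full_of_new {S : Finset (Fin m ⊕ Fin m)} (hS : D.New S) : D.Full S := by
  by_contra hfull
  simp only [Full, not_exists, not_and, not_not] at hfull
  apply hS
  refine (D.canon₂_le_iSup_inf S).trans (iSup_le fun w => ?_)
  by_cases hsu : supp₂ w.1 = S
  · rw [hfull w w.2 hsu]; exact bot_le
  · have hss : supp₂ w.1 ⊂ S := Finset.ssubset_iff_subset_ne.2 ⟨w.2.2, hsu⟩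
    exact (D.canon₂_inf_wt_le_canon₂_supp w.2).trans (le_biSup (fun S' => canon₂ D.Λ D.A S') hss)

omit [FiniteDimensional ℂ V] in
/-- **Covariance**: NEW is transported by the lift of a permutation PAIR. [cite: LandsbergRessayre2017, §6] -/
theorem new_map {S : Finset (Fin m ⊕ Fin m)} (σ π : Equiv.Perm (Fin m))
    (L : Lift₂ D.Λ D.A σ⁻¹ π⁻¹ fun _ => (1 : ℂ)) (hS : D.New S) :
    D.New (S.map (Equiv.sumCongr σ π).toEmbedding) := by
  intro h
  have h' := L.canon₂_le_iSup_ssubsets_transfer h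
  have hSS : (S.map (Equiv.sumCongr σ π).toEmbedding).map (Equiv.sumCongr σ⁻¹ π⁻¹).toEmbedding = S := by
    ext x
    simp only [mem_map_equiv, Equiv.Perm.inv_def]
    rcases x with k | j <;> simp [Equiv.sumCongr_symm, Equiv.sumCongr_apply]
  rw [hSS] at h'
  exact hS h'

/-- `𝔖_m × 𝔖_m` is transitive on the index sets with `s` rows and `s'` columns: the support of a
`0/1` exponent of row degree `|R|` and column degree `|T|` is moved onto `R ⊔ T` by some
permutation pair. [folklore] -/
theorem exists_perm_pair_map_eq {w : Fin m ⊕ Fin m → ℕ} (hw : ∀ x, w x ≤ 1) (R T : Finset (Fin m))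
    (hR : rowDeg w = R.card) (hT : colDeg w = T.card) :
    ∃ σ π : Equiv.Perm (Fin m), (supp₂ w).map (Equiv.sumCongr σ π).toEmbedding = R.disjSum T := by
  obtain ⟨σ, hσ⟩ := Equiv.Perm.exists_map_finset_eq (rows w) R (by rw [card_rows_eq hw, hR])
  obtain ⟨π, hπ⟩ := Equiv.Perm.exists_map_finset_eq (cols w) T (by rw [card_cols_eq hw, hT])
  refine ⟨σ, π, ?_⟩
  ext x
  rw [mem_map_equiv, supp₂_eq_disjSum]
  rcases x with k | j
  · simp only [Equiv.sumCongr_symm, Equiv.sumCongr_apply, Sum.map_inl, Finset.inl_mem_disjSum]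
    rw [← hσ, mem_map_equiv]
  · simp only [Equiv.sumCongr_symm, Equiv.sumCongr_apply, Sum.map_inr, Finset.inr_mem_disjSum]
    rw [← hπ, mem_map_equiv]

/-- **Every `R ⊔ T` with `|R| = |T| = s`, `1 ≤ s ≤ m`, is full** (LR17 §6: the profiles `(s, s)` all
occur along the chain, and `𝔖_m × 𝔖_m` is transitive on them). [cite: LandsbergRessayre2017, §6] -/
theorem full_disjSum (hgood : D.Good (fun _ => 1))
    (hperm : ∀ σ π : Equiv.Perm (Fin m), Nonempty (Lift₂ D.Λ D.A σ π fun _ => (1 : ℂ)))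
    {R T : Finset (Fin m)} (hRT : R.card = T.card) (h1 : 1 ≤ R.card) (hRm : R.card ≤ m) :
    D.Full (R.disjSum T) := by
  obtain ⟨w, hw, hw1, hr, hc⟩ := D.exists_good_profile hgood (m - R.card) (by omega)
  have hr' : rowDeg w = R.card := by omega
  have hc' : colDeg w = T.card := by omega
  obtain ⟨σ, π, hmap⟩ := exists_perm_pair_map_eq hw1 R T hr' hc'
  obtain ⟨L⟩ := hperm σ⁻¹ π⁻¹
  have hnew := D.new_map σ π L (D.new_of_full (D.full_supp_of_good hw))
  rw [hmap] at hnew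
  exact D.full_of_new hnew

end FullNew

/-! ### The count -/

section Count

variable [FiniteDimensional ℂ V]

/-- `disjSum` is injective in each argument. [folklore] -/
theorem disjSum_injective {R R' T T' : Finset (Fin m)} (h : R.disjSum T = R'.disjSum T') :
    R = R' ∧ T = T' := by
  constructor
  · ext k
    have := Finset.ext_iff.1 h (Sum.inl k)
    simpa using this
  · ext j
    have := Finset.ext_iff.1 h (Sum.inr j)
    simpa using this

/-- `supp₂ 1 = [m] ⊔ [m] = univ.disjSum univ`. [folklore] -/
theorem supp₂_one : supp₂ (fun _ : Fin m ⊕ Fin m => 1) = (univ : Finset (Fin m)).disjSum univ := by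
  ext x; rcases x with k | j <;> simp [supp₂]

/-- `C(2m, m) ≥ 2` for `m ≥ 1`. [folklore] -/
theorem two_le_choose (hm : 1 ≤ m) : 2 ≤ (2 * m).choose m := by
  have h := LR21.card_filter_card_eq_card m
  have hsub : ({((∅, ∅) : Finset (Fin m) × Finset (Fin m)), (univ, univ)} : Finset _) ⊆
      univ.filter fun RT : Finset (Fin m) × Finset (Fin m) => RT.1.card = RT.2.card := by
    intro x hx
    simp only [mem_insert, mem_singleton] at hx
    rcases hx with rfl | rfl <;> simp
  have hne : ((∅, ∅) : Finset (Fin m) × Finset (Fin m)) ≠ (univ, univ) := by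
    intro h'
    have h1 : (∅ : Finset (Fin m)) = univ := congrArg Prod.fst h'
    have : (univ : Finset (Fin m)).card = 0 := by rw [← h1]; rfl
    rw [card_univ, Fintype.card_fin] at this
    omega
  have := card_le_card hsub
  rw [card_pair hne, h] at this
  exact this

/-- **LR17 Thm. 2.1, lower bound, abstract form.**  For a two-sided torus datum with
`dim ker Λ = 1` (regularity), an injective member of the pencil (`det Ã ≠ 0`), exact lifts of all
permutation pairs, and the top-weight property (every weight `β ≠ wt 1` lies in `range Λ` — for a
representation of `perm_m` this is the character identity of `LRLiftCharacter`), `dim V ≥ C(2m,m) - 1`: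
the `C(2m,m) - 2` weights `wt w_{R,T}` (support `R ⊔ T`, `|R| = |T| = s`, `1 ≤ s ≤ m - 1`) and the
top weight `wt 1` are pairwise distinct and all occur. [cite: LandsbergRessayre2017, Thm. 2.1] -/
theorem choose_sub_one_le_finrank (hm : 1 ≤ m) (hK : Module.finrank ℂ (LinearMap.ker D.Λ) = 1)
    (hgen : ∃ x : Fin m → Fin m → ℂ, Function.Injective (D.Λ + ∑ k, ∑ j, x k j • D.A k j))
    (hperm : ∀ σ π : Equiv.Perm (Fin m), Nonempty (Lift₂ D.Λ D.A σ π fun _ => (1 : ℂ)))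
    (htop : ∀ β, β ≠ D.wt (fun _ => 1) → D.E β ≤ LinearMap.range D.Λ) :
    (2 * m).choose m - 1 ≤ Module.finrank ℂ V := by
  classical
  have hgood : D.Good (fun _ => 1) := D.good_one hK hgen htop
  -- one exponent of support `R ⊔ T` for each proper pair with `|R| = |T|`
  let 𝒮 := {RT : Finset (Fin m) × Finset (Fin m) // RT.1.card = RT.2.card ∧ RT.1 ≠ ∅ ∧ RT.1 ≠ univ}
  have hfull : ∀ RT : 𝒮, D.Full (RT.1.1.disjSum RT.1.2) := fun RT => by
    refine D.full_disjSum hgood hperm RT.2.1 ?_ ?_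
    · rw [Nat.one_le_iff_ne_zero]; exact fun h => RT.2.2.1 (card_eq_zero.1 h)
    · exact (card_le_univ _).trans (by rw [Fintype.card_fin])
  choose wS hwS hsuppS hneS using hfull
  -- the family of weights
  let g : 𝒮 ⊕ Unit → ℂ := fun i => match i with
    | Sum.inl RT => D.wt (wS RT)
    | Sum.inr _ => D.wt (fun _ => 1)
  have hg : Function.Injective g := by
    rintro (RT | _) (RT' | _) h
    · have h1 : wS RT = wS RT' := D.wt_injective h
      have h2 : RT.1.1.disjSum RT.1.2 = RT'.1.1.disjSum RT'.1.2 := by rw [← hsuppS RT, ← hsuppS RT', h1]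
      obtain ⟨h3, h4⟩ := disjSum_injective h2
      have : RT.1 = RT'.1 := Prod.ext h3 h4
      rw [Subtype.ext this]
    · have h1 : wS RT = fun _ => 1 := D.wt_injective h
      have h2 : RT.1.1.disjSum RT.1.2 = (univ : Finset (Fin m)).disjSum univ := by
        rw [← hsuppS RT, h1, supp₂_one]
      exact (RT.2.2.2 (disjSum_injective h2).1).elim
    · have h1 : (fun _ => 1) = wS RT' := D.wt_injective h
      have h2 : (univ : Finset (Fin m)).disjSum univ = RT'.1.1.disjSum RT'.1.2 := by
        rw [← hsuppS RT', ← h1, supp₂_one]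
      exact (RT'.2.2.2 (disjSum_injective h2).1.symm).elim
    · rfl
  have hind : iSupIndep (D.E ∘ g) := D.B.independent_maxGenEigenspace.comp hg
  have hne : ∀ i, (D.E ∘ g) i ≠ ⊥ := by
    rintro (RT | _)
    · exact fun h => hneS RT (by rw [eq_bot_iff, ← h]; exact inf_le_right)
    · exact fun h => hgood.2 (by rw [eq_bot_iff, ← h]; exact inf_le_right)
  have hcard := hind.subtype_ne_bot_le_finrank
  rw [Fintype.card_congr (Equiv.subtypeUnivEquiv hne), Fintype.card_sum, Fintype.card_unit,
    Fintype.card_subtype] at hcard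
  have h𝒮 : (univ.filter fun RT : Finset (Fin m) × Finset (Fin m) =>
      RT.1.card = RT.2.card ∧ RT.1 ≠ ∅ ∧ RT.1 ≠ univ).card = (2 * m).choose m - 2 :=
    LR21.card_filter_card_eq_card_proper hm
  rw [h𝒮] at hcard
  have h2 := two_le_choose hm
  omega

end Count

end TorusData₂

end LRPencil

/-! ## Part 2: assembly -/

open LRPencil

/-- **LR17 Thm. 2.1, lower bound, for one representation**: a fully equivariant (exact lifts for
`permSymmetrySubst`) affine determinantal representation of `perm_m` (`m ≥ 3`) over `ℂ` has size
`n ≥ C(2m, m) - 1`. [cite: LandsbergRessayre2017, Thm. 2.1] -/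
theorem choose_sub_one_le_of_isEquivariantDetRepr {m : ℕ} (hm : 3 ≤ m) {n : ℕ}
    {A : Matrix (Fin n) (Fin n) (MvPolynomial (Fin m × Fin m) ℂ)}
    (hA : IsEquivariantDetRepr (permSymmetrySubst ℂ m) (perPoly (Fin m) ℂ) A) :
    Nat.choose (2 * m) m - 1 ≤ n := by
  obtain ⟨D, -, -, -, hK, hgen, hperm, htop⟩ := exists_torusData₂ hm hA
  have h := D.choose_sub_one_le_finrank (by omega) hK hgen hperm htop
  rwa [Module.finrank_fin_fun] at h

/-- **DISCHARGE of the named fact `lr_full_equivariant_lower`** (Landsberg–Ressayre 2017,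
Thm. 2.1, lower bound): for `m ≥ 3`, every affine determinantal representation of `perm_m` over `ℂ`
equivariant for the full realised symmetry group `permSymmetrySubst` has size at least `C(2m, m) - 1`.
[cite: LandsbergRessayre2017, Thm. 2.1] -/
theorem lr_full_equivariant_lower_holds : lr_full_equivariant_lower :=
  fun _ hm _ _ hA => choose_sub_one_le_of_isEquivariantDetRepr hm hA

/-- In terms of `edc`: if some fully equivariant representation exists (so that `edc` is not the
junk `0`), then `edc(perm_m) ≥ C(2m,m) - 1` for the full symmetry group (LR17 Thm. 2.1; their
Prop. 2.10 exhibits one, not vendored). [cite: LandsbergRessayre2017, Thm. 2.1] -/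
theorem le_equivariantDetComplexity_full {m : ℕ} (hm : 3 ≤ m)
    (hex : ∃ n, HasEquivariantDetRepr (permSymmetrySubst ℂ m) (perPoly (Fin m) ℂ) n) :
    Nat.choose (2 * m) m - 1 ≤ equivariantDetComplexity (permSymmetrySubst ℂ m) (perPoly (Fin m) ℂ) := by
  obtain ⟨A, hA⟩ : HasEquivariantDetRepr (permSymmetrySubst ℂ m) (perPoly (Fin m) ℂ)
      (equivariantDetComplexity (permSymmetrySubst ℂ m) (perPoly (Fin m) ℂ)) := Nat.sInf_mem hex
  exact choose_sub_one_le_of_isEquivariantDetRepr hm hA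

end Literature.Computability.AlgebraicComplexity
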